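import Summits.QuantumFields.BalabanUV.Beta.D1BFx.GluonLocalNdlLetters
import Summits.QuantumFields.BalabanUV.Beta.D1BFx.LocalVertexFormLeft
import Summits.QuantumFields.BalabanUV.Beta.D1BFx.GluonLocalProjWord
import Summits.QuantumFields.BalabanUV.Beta.D1BFx.NeedleProjNdlRow

/-!
# `BalabanUV.Beta.D1BFx.GluonNdlLocalWord` — road «BF-x» for binder row D1, slot (K), END row `hGrp gN`, «GN-Q-T₂» part 1: THE `ndl ⊗ SbT` WORD OF THE GLUON NEEDLE
# ROW T₂ AT ONE `(b, w)` (the T₂ mirror of `GluonLocalNdlWord`) — needle at the PARTNER bond `u = b+w`, the transverse stencil at the BASE `b`, on the OWNER's transposed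
# frame `LocalVertexFormLeft.exists_SbT_outer_bound_left`: `|word(b,w)| ≤ K·((KΦ′c₂·Σ_{s∈B(blk u)}|qJet_u s|E₂(b−s))·(KN+KN′) + (KΦc₁·Σ_s|qJet_u s|E₁(b−s))·KN′)`

HONEST DEPENDENCY (cell records, verbatim): «continuum YM on T⁴ ⇐ BetaPertH ∧ nine spine estimates (0/9 proved); BetaPertH ⇐ (D1) ∧ (D4) ∧
CAP+tail; G-an2-4 gates asym, D1 and NE2/3/4.»  HONEST FRAMING (cell contract, verbatim): «discharging `BetaPertH` makes Bałaban's UV stability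
UNCONDITIONAL — a real constructive-QFT result; it is NOT the continuum limit and NOT the Clay problem.»  THIS MODULE DISCHARGES NOTHING of the
wall: [folklore] counting BY NAME on the owner's transposed frame `LocalVertexFormLeft.exists_SbT_outer_bound_left` (taken as a HYPOTHESIS in its shape), the window
shift `GluonLocalProjWord.profile_window`, the owner's `NeedleNdlShape.ndlPiece_eq_outer` ∕ `locV_*`, `NeedleColumnLetters.abs_gradC_le` ∕ `applyKT_eq_applyK_of_symm`,
`RankOneBubble.bubble_outer_sub_left`, `SectorRecut.exists_biLoc_SbT`; the letters are ABSTRACT hypotheses.  No `def`, no `def … : Prop`, nothing cited, 0 sorry.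
Root-level binders hW ∕ hR-sockets ∕ hSX-socket ∕ D1Tel ∕ D1Rep — 0 discharged; (K) NOT closed; NOT D1, NOT `BetaPertH`, NOT continuum, NOT Clay.

ABSOLUTE RULE (cell charter, verbatim): «No internally-minted statement may enter as a cited fact. Every hypothesis is either kernel-proved in
this package or a verbatim quotation of a PUBLISHED theorem with page reference. The manuscript(s) under audit are NOT citable for their own
disputed steps — they are the thing under adjudication; programme-internal (2001/route/tribunal) claims are never citable.»

WHY (owner d1-p2-g10 SEAT-CLOSING l.31284: «UNCLAIMED … T₂-P∕K∕Q̇ — all on landed frames (`exists_SbT_outer_bound(_left)` …)»).  The T₂ word at `(b,w)` is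
`−½·biBubble Ga (ndlPiece μ (b+w)) Ga (SbT ν b)`; with `ndlPiece = ∇C_u ⊗ ∇ρ_u − ∇ρ_u ⊗ ∇C_u` the transposed frame bounds each rank-one term by `K·(Φ₁Γ₀ + Φ₀Γ₁ + Φ₁Γ₁)` from
the window letters of the ends `ψGa` and `Gaφ` around the BASE vertex `b`: the needle end `Ga∇ρ_u` read near `b` is `(kΦ∕n²)·c₁·Σ_{s∈B(blk u)}|qJet_u s|·E₁(b−s)` (value) and
`(kΦ′∕n²)·c₂·Σ_s|qJet_u s|·E₂(b−s)` (unit difference), the column end has the sups `kN·C₁·n`, `kN′·C₁` — the SAME three products as the T₁ piece with the damped envelopes now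
centred at the base and the needle weights those of the PARTNER bond (so the census is paid at the `w`-sum in part 2, `GluonNdlLocalRow`).

CONTENT (`a > 0`, `n ≥ 1`).
* §1 [folklore] **`abs_ndlLoc_word_le`** — pointwise, from the abstract transposed frame `K, R` and abstract letters `KΦ`, `KΦ′` (needle-weighted, damped), `KN`, `KN′` (sups).
NOT HERE (honest): the (1.22) sum and the piece (part 2 `GluonNdlLocalRow`); T₂-P (S-sized on the same frame), T₂-K.
Unit `b2b-balaban-beta-d1-formalise-leaf-01` (gen 15), D1 formalisation swarm LEAF PROVER 01 on cross-road kernel duty; `LEAVES-BFx.md` row (N) «GN-Q-T₂» part 1.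
-/

noncomputable section

namespace Summit.QuantumFields.BalabanUV.Beta.D1BFx.GluonNdlLocalWord

open Finset
open scoped BigOperators
open Literature.MathematicalPhysics.QuantumFieldTheory.Balaban1983to89
open Literature.MathematicalPhysics.QuantumFieldTheory.Balaban1983to89.Beta
open B12Sec2to5 (l1 l1_nonneg)
open B4Sect5Proof (latticeConst latticeConst_nonneg)
open B6QGQLower276 (X e blk B mem_B)
open B6QGQDecay237 (card_B)
open ExpKernelCalculus (Site MKer Decays bubble summable_exp_shift summable_exp_shift')
open DyadicShell (Pt toReal toReal_apply)
open WindowIdentification (fullSum)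
open DressedMomentNormalisation (resSite)
open AffineAveraging (unitVec)
open VectorTailsLoc (fam kfam)
open Beta.PoissonInterior (nrm nrm_pos one_le_nrm nrm_neg supNorm_le_nrm)
open Summit.QuantumFields.BalabanUV.Beta.TameKernelCalculus (Spr Loc)
open Summit.QuantumFields.BalabanUV.Beta.D1BFx.PackedKernelSplit (biBubble bubble_eq_biBubble)
open Summit.QuantumFields.BalabanUV.Beta.D1BFx.FineHessianSectors (biBubbleTable biBubbleTable_apply)
open Summit.QuantumFields.BalabanUV.Beta.D1BFx.RProjector (Pgt kerP deltaPP deltaP deltaPP_pos deltaP_pos)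
open Summit.QuantumFields.BalabanUV.Beta.D1BFx.ProjectorSupNorm (cPPs cPs cPPs_nonneg cPs_nonneg)
open Summit.QuantumFields.BalabanUV.Beta.D1BFx.GluonLeg (Ga Ga_apply Ga_symm)
open Summit.QuantumFields.BalabanUV.Beta.D1BFx.GluonLegTails (spr_Ga_of_prop12)
open Summit.QuantumFields.BalabanUV.Beta.D1BFx.FrozenLegTails (nOf MOf hn1)
open Summit.QuantumFields.BalabanUV.Beta.D1BFx.GhostLeg (cast_pred_add_one)
open Summit.QuantumFields.BalabanUV.Beta.D1BFx.GhostStencil (qJet)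
open Summit.QuantumFields.BalabanUV.Beta.D1BFx.SectorRecut (SbT exists_biLoc_SbT)
open Summit.QuantumFields.BalabanUV.Beta.D1BFx.GluonNeedleSplit (ndlPiece)
open Summit.QuantumFields.BalabanUV.Beta.D1BFx.GluonNeedleGlue (cellSum cellSum_def)
open Summit.QuantumFields.BalabanUV.Beta.D1BFx.RankOneBubble (outer applyK applyKT pairing applyK_apply applyKT_apply bubble_outer_sub_left LocV)
open Summit.QuantumFields.BalabanUV.Beta.D1BFx.RankOneBubbleJets (grad grad_apply locV_grad_of_locV)
open Summit.QuantumFields.BalabanUV.Beta.D1BFx.NeedlePotentialLetters (ndlRow abs_ndlRow_diff_le)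
open Summit.QuantumFields.BalabanUV.Beta.D1BFx.RColumnBlockMass (dR cRd dR_pos cRd_nonneg)
open Summit.QuantumFields.BalabanUV.Beta.D1BFx.NeedleNdlShape (ndlPiece_eq_outer locV_ndlRow locV_combinedColumn)
open Summit.QuantumFields.BalabanUV.Beta.D1BFx.NeedleColumnLetters (applyKT_eq_applyK_of_symm abs_gradC_le exists_applyK_gradC_le)
open Summit.QuantumFields.BalabanUV.Beta.D1BFx.NeedleNdlProjLetters (exists_applyK_grad_row_le)
open Summit.QuantumFields.BalabanUV.Beta.D1BFx.GluonLocalNdlLetters (exists_applyK_grad_row_diff_le exists_applyK_gradC_diff_le)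
open Summit.QuantumFields.BalabanUV.Beta.D1BFx.NeedleProjNdlRow (abs_weight_le_of_mem_B sum_resSite_needle_weight_le)
open Summit.QuantumFields.BalabanUV.Beta.D1BFx.GluonLocalProjWord (profile_window)
open Summit.QuantumFields.BalabanUV.Beta.D1BFx.LatticeHLSProfiles (supNorm_dyadic)
open Summit.QuantumFields.BalabanUV.Beta.D1BFx.LatticeHLSPairing (abs_fullSum_le_of_abs_sum_le)
open Summit.QuantumFields.BalabanUV.Beta.D1BFx.LocalVertexForm (exists_SbT_outer_bound_left)

variable (n : ℕ) [NeZero n] (a : ℝ)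

/-! ## §1 The `ndl ⊗ SbT` word at one `(b, w)`: transposed frame × letters -/

/-- [folklore] **THE `ndl ⊗ SbT` WORD AT ONE `(b, w)`** from the abstract transposed frame (`K`, `R`, the conclusion of `LocalVertexFormLeft.exists_SbT_outer_bound_left`)
and abstract letters (needle end: `KΦ` degree 1, `KΦ′` degree 2, needle weights of the PARTNER bond `u = b+w` inside; column end: sups `KN`, `KN′`):
`|biBubbleTable Ga Ga ndl SbT μ ν (b+w) b| ≤ K·((KΦ′·c₂·Σ_{s∈B(blk(b+w))}|qJet_{b+w} s|·E₂(b−s))·(KN + KN′) + (KΦ·c₁·Σ_s|qJet_{b+w} s|·E₁(b−s))·KN′)`, `E_p(v) = e^{−(ε∕n)‖v‖}∕nrm(v)^p`,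
`c_p = e^{εR}(R+1)^p`. -/
theorem abs_ndlLoc_word_le (ha : 0 < a) (hA : Spr (Ga n a)) {K : ℝ} {R : ℕ}
    (hframe : ∀ (κ : Fin 4) (u : Pt) (A B : MKer 4 (Fin 4)) (φ ψ : Pt → Fin 4 → ℝ),
      (∀ (r : Pt) (g : Fin 4), Summable fun y : Pt => ∑ a', ψ y a' * B y r a' g) →
      ∀ (Φ₀ Φ₁ Γ₀ Γ₁ : ℝ), 0 ≤ Φ₀ → 0 ≤ Φ₁ → 0 ≤ Γ₀ → 0 ≤ Γ₁ →
      (∀ (q : Pt) (g : Fin 4), DyadicShell.supNorm (q - u) ≤ R → |applyKT ψ B q g| ≤ Φ₀) →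
      (∀ (q : Pt) (g : Fin 4) (i : Fin 4), DyadicShell.supNorm (q - u) ≤ R → |applyKT ψ B (q + unitVec i) g - applyKT ψ B q g| ≤ Φ₁) →
      (∀ (q : Pt) (f : Fin 4), DyadicShell.supNorm (q - u) ≤ R → |applyK A φ q f| ≤ Γ₀) →
      (∀ (q : Pt) (f : Fin 4) (i : Fin 4), DyadicShell.supNorm (q - u) ≤ R → |applyK A φ (q + unitVec i) f - applyK A φ q f| ≤ Γ₁) →
      |biBubble A (outer φ ψ) B (SbT κ u)| ≤ K * (Φ₁ * Γ₀ + Φ₀ * Γ₁ + Φ₁ * Γ₁))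
    {cQ KΦ KΦ' KN KN' ε : ℝ} (hKΦ : 0 ≤ KΦ) (hKΦ' : 0 ≤ KΦ') (hKN : 0 ≤ KN) (hKN' : 0 ≤ KN') (hε : 0 < ε)
    (hΦ : ∀ (κ : Fin 4) (u x : Pt) (α : Fin 4), |applyK (Ga n a) (grad (ndlRow n a κ u)) x α|
      ≤ KΦ * ∑ s ∈ B (n - 1) (blk (n - 1) u), |qJet n κ u (blk (n - 1) u) s|
          * (Real.exp (-(ε / n) * PoissonInterior.supNorm (d := 4) (x - s)) / nrm (x - s) ^ 1))
    (hΦ' : ∀ (κ : Fin 4) (u x : Pt) (α i : Fin 4), |applyK (Ga n a) (grad (ndlRow n a κ u)) (x + unitVec i) α - applyK (Ga n a) (grad (ndlRow n a κ u)) x α|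
      ≤ KΦ' * ∑ s ∈ B (n - 1) (blk (n - 1) u), |qJet n κ u (blk (n - 1) u) s|
          * (Real.exp (-(ε / n) * PoissonInterior.supNorm (d := 4) (x - s)) / nrm (x - s) ^ 2))
    (hN : ∀ (u x : Pt) (α : Fin 4), |applyK (Ga n a)
        (grad (fun q => cQ * (∑ z ∈ B (n - 1) (blk (n - 1) u), Pgt n a z q () ()) - kerP (d := 4) (n - 1) a q (blk (n - 1) u))) x α| ≤ KN)
    (hN' : ∀ (u x : Pt) (α i : Fin 4), |applyK (Ga n a)
        (grad (fun q => cQ * (∑ z ∈ B (n - 1) (blk (n - 1) u), Pgt n a z q () ()) - kerP (d := 4) (n - 1) a q (blk (n - 1) u))) (x + unitVec i) α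
        - applyK (Ga n a) (grad (fun q => cQ * (∑ z ∈ B (n - 1) (blk (n - 1) u), Pgt n a z q () ()) - kerP (d := 4) (n - 1) a q (blk (n - 1) u))) x α|
        ≤ KN')
    (μ ν : Fin 4) (b w : Pt) :
    |biBubbleTable (Ga n a) (Ga n a) (ndlPiece n a cQ) SbT μ ν (b + w) b|
      ≤ K * ((KΦ' * (Real.exp (ε * R) * ((R : ℝ) + 1) ^ 2) * ∑ s ∈ B (n - 1) (blk (n - 1) (b + w)), |qJet n μ (b + w) (blk (n - 1) (b + w)) s| *
            (Real.exp (-(ε / n) * PoissonInterior.supNorm (d := 4) (b - s)) / nrm (b - s) ^ 2)) * (KN + KN')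
          + (KΦ * (Real.exp (ε * R) * ((R : ℝ) + 1) ^ 1) * ∑ s ∈ B (n - 1) (blk (n - 1) (b + w)), |qJet n μ (b + w) (blk (n - 1) (b + w)) s| *
            (Real.exp (-(ε / n) * PoissonInterior.supNorm (d := 4) (b - s)) / nrm (b - s) ^ 1)) * KN') := by
  have hn1 : 1 ≤ n := NeZero.one_le
  have hn : (0 : ℝ) < n := by exact_mod_cast Nat.pos_of_ne_zero (NeZero.ne n)
  set m : ℕ := n - 1 with hm
  set u : Pt := b + w with hu
  set Cf : Pt → ℝ := fun q => cQ * (∑ z ∈ B m (blk m u), Pgt n a z q () ()) - kerP (d := 4) m a q (blk m u) with hCf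
  set Wq : Pt → ℝ := fun s => |qJet n μ u (blk m u) s| with hWq
  set E₁ : Pt → ℝ := fun s => Real.exp (-(ε / n) * PoissonInterior.supNorm (d := 4) (b - s)) / nrm (b - s) ^ 1 with hE₁
  set E₂ : Pt → ℝ := fun s => Real.exp (-(ε / n) * PoissonInterior.supNorm (d := 4) (b - s)) / nrm (b - s) ^ 2 with hE₂
  set c₁ : ℝ := Real.exp (ε * R) * ((R : ℝ) + 1) ^ 1 with hc₁
  set c₂ : ℝ := Real.exp (ε * R) * ((R : ℝ) + 1) ^ 2 with hc₂
  set Φ0 : ℝ := KΦ * c₁ * ∑ s ∈ B m (blk m u), Wq s * E₁ s with hΦ0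
  set Φ1 : ℝ := KΦ' * c₂ * ∑ s ∈ B m (blk m u), Wq s * E₂ s with hΦ1
  have hS₁0 : 0 ≤ ∑ s ∈ B m (blk m u), Wq s * E₁ s :=
    Finset.sum_nonneg fun s _ => mul_nonneg (abs_nonneg _) (div_nonneg (Real.exp_pos _).le (pow_nonneg (nrm_pos _).le 1))
  have hS₂0 : 0 ≤ ∑ s ∈ B m (blk m u), Wq s * E₂ s :=
    Finset.sum_nonneg fun s _ => mul_nonneg (abs_nonneg _) (div_nonneg (Real.exp_pos _).le (pow_nonneg (nrm_pos _).le 2))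
  have hΦ0pos : 0 ≤ Φ0 := by positivity
  have hΦ1pos : 0 ≤ Φ1 := by positivity
  -- window bookkeeping around the BASE vertex `b`
  have hwin : ∀ q : Pt, DyadicShell.supNorm (q - b) ≤ R → PoissonInterior.supNorm (d := 4) (q - b) ≤ R := fun q hq => by rwa [supNorm_dyadic] at hq
  have hqs : ∀ q s : Pt, q - s = (b - s) + (q - b) := fun q s => by abel
  have hwΦ0 : ∀ (q : Pt) (g : Fin 4), DyadicShell.supNorm (q - b) ≤ R → |applyK (Ga n a) (grad (ndlRow n a μ u)) q g| ≤ Φ0 := by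
    intro q g hq
    refine (hΦ μ u q g).trans ?_
    have hs : ∀ s ∈ B m (blk m u), Wq s * (Real.exp (-(ε / n) * PoissonInterior.supNorm (d := 4) (q - s)) / nrm (q - s) ^ 1) ≤ c₁ * (Wq s * E₁ s) := by
      intro s _
      have h := profile_window (k := Wq s) (abs_nonneg _) hε.le hn1 1 (w := b - s) (hwin q hq)
      rw [← hqs q s] at h
      calc Wq s * (Real.exp (-(ε / n) * PoissonInterior.supNorm (d := 4) (q - s)) / nrm (q - s) ^ 1)
          = Wq s * Real.exp (-(ε / n) * PoissonInterior.supNorm (d := 4) (q - s)) / nrm (q - s) ^ 1 := by ring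
        _ ≤ Wq s * (Real.exp (ε * R) * ((R : ℝ) + 1) ^ 1) * (Real.exp (-(ε / n) * PoissonInterior.supNorm (d := 4) (b - s)) / nrm (b - s) ^ 1) := h
        _ = c₁ * (Wq s * E₁ s) := by rw [hc₁, hE₁]; ring
    calc KΦ * ∑ s ∈ B m (blk m u), Wq s * (Real.exp (-(ε / n) * PoissonInterior.supNorm (d := 4) (q - s)) / nrm (q - s) ^ 1)
        ≤ KΦ * ∑ s ∈ B m (blk m u), c₁ * (Wq s * E₁ s) := mul_le_mul_of_nonneg_left (Finset.sum_le_sum hs) hKΦ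
      _ = Φ0 := by rw [hΦ0, ← Finset.mul_sum]; ring
  have hwΦ1 : ∀ (q : Pt) (g i : Fin 4), DyadicShell.supNorm (q - b) ≤ R →
      |applyK (Ga n a) (grad (ndlRow n a μ u)) (q + unitVec i) g - applyK (Ga n a) (grad (ndlRow n a μ u)) q g| ≤ Φ1 := by
    intro q g i hq
    refine (hΦ' μ u q g i).trans ?_
    have hs : ∀ s ∈ B m (blk m u), Wq s * (Real.exp (-(ε / n) * PoissonInterior.supNorm (d := 4) (q - s)) / nrm (q - s) ^ 2) ≤ c₂ * (Wq s * E₂ s) := by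
      intro s _
      have h := profile_window (k := Wq s) (abs_nonneg _) hε.le hn1 2 (w := b - s) (hwin q hq)
      rw [← hqs q s] at h
      calc Wq s * (Real.exp (-(ε / n) * PoissonInterior.supNorm (d := 4) (q - s)) / nrm (q - s) ^ 2)
          = Wq s * Real.exp (-(ε / n) * PoissonInterior.supNorm (d := 4) (q - s)) / nrm (q - s) ^ 2 := by ring
        _ ≤ Wq s * (Real.exp (ε * R) * ((R : ℝ) + 1) ^ 2) * (Real.exp (-(ε / n) * PoissonInterior.supNorm (d := 4) (b - s)) / nrm (b - s) ^ 2) := h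
        _ = c₂ * (Wq s * E₂ s) := by rw [hc₂, hE₂]; ring
    calc KΦ' * ∑ s ∈ B m (blk m u), Wq s * (Real.exp (-(ε / n) * PoissonInterior.supNorm (d := 4) (q - s)) / nrm (q - s) ^ 2)
        ≤ KΦ' * ∑ s ∈ B m (blk m u), c₂ * (Wq s * E₂ s) := mul_le_mul_of_nonneg_left (Finset.sum_le_sum hs) hKΦ'
      _ = Φ1 := by rw [hΦ1, ← Finset.mul_sum]; ring
  -- localisation data and the split of `ndlPiece`
  obtain ⟨Cs, δs, hδs, hS⟩ := exists_biLoc_SbT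
  have hLocS : Loc (SbT ν b) := ⟨b, b, Cs, δs, hδs, hS ν b⟩
  have hLr : LocV (grad (ndlRow n a μ u)) := locV_grad_of_locV (locV_ndlRow n a μ u ha)
  have hLc : LocV (grad Cf) := locV_grad_of_locV (locV_combinedColumn n a cQ u ha)
  have hword : biBubbleTable (Ga n a) (Ga n a) (ndlPiece n a cQ) SbT μ ν (b + w) b =
      -(1 / 2 : ℝ) * (bubble (Ga n a) (outer (grad Cf) (grad (ndlRow n a μ u))) (SbT ν b)
        - bubble (Ga n a) (outer (grad (ndlRow n a μ u)) (grad Cf)) (SbT ν b)) := by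
    rw [biBubbleTable_apply, ← hu, ndlPiece_eq_outer n a cQ μ u ha, ← bubble_eq_biBubble, bubble_outer_sub_left hA hLocS hLc hLr hLr hLc]
  -- summability of the two row ends (bounded bond functions against the spread leg)
  have hsumψ : ∀ {ψ : Pt → Fin 4 → ℝ} {M : ℝ}, (∀ y c, |ψ y c| ≤ M) → ∀ (r : Pt) (g : Fin 4), Summable fun x : Pt => ∑ a', ψ x a' * Ga n a x r a' g := by
    intro ψ M hM r g
    obtain ⟨C, δ', hδ', hGa⟩ := hA
    have hC : 0 ≤ C := hGa.nonneg g
    have hM0 : 0 ≤ M := (abs_nonneg _).trans (hM r g)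
    refine Summable.of_norm_bounded (g := fun x => ∑ _a' : Fin 4, M * (C * Real.exp (-δ' * l1 (x - r)))) ?_ fun x => ?_
    · exact summable_sum fun a' _ => ((summable_exp_shift' hδ' r).mul_left C).mul_left M
    · rw [Real.norm_eq_abs]
      refine (Finset.abs_sum_le_sum_abs _ _).trans (Finset.sum_le_sum fun a' _ => ?_)
      rw [abs_mul]
      exact mul_le_mul (hM x a') (hGa x r a' g) (abs_nonneg _) hM0
  have hbr : ∀ (y : Pt) (c : Fin 4), |grad (ndlRow n a μ u) y c| ≤ ((n : ℝ) ^ 4)⁻¹ * (cRd a / n * 1) := fun y c => by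
    rw [grad_apply]
    refine (abs_ndlRow_diff_le n μ u ha y c).trans (mul_le_mul_of_nonneg_left (mul_le_mul_of_nonneg_left ?_ (div_nonneg (cRd_nonneg ha) hn.le))
      (by positivity))
    rw [Real.exp_le_one_iff]; have : 0 ≤ dR a * dist (blk m y) (blk m u) := by have := dR_pos (a := a) ha; positivity
    linarith
  have hbc : ∀ (y : Pt) (c : Fin 4), |grad Cf y c| ≤ (|cQ| * cPPs 4 a + cPs 4 a) / (n : ℝ) := fun y c => by
    refine (abs_gradC_le a ha n cQ u y c).trans (mul_le_of_le_one_right (by have := cPPs_nonneg 4 ha; have := cPs_nonneg 4 ha; positivity) ?_)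
    rw [Real.exp_le_one_iff]
    have : 0 ≤ min (deltaPP 4 a) (deltaP 4 a) * dist (blk m u) (blk m y) := by
      have := deltaPP_pos 4 ha; have := deltaP_pos 4 ha; positivity
    linarith
  -- term 1: the end `∇ρ_u Ga` (ψ) and the end `Ga ∇C_u` (φ)
  have ht1 : |bubble (Ga n a) (outer (grad Cf) (grad (ndlRow n a μ u))) (SbT ν b)| ≤ K * (Φ1 * KN + Φ0 * KN' + Φ1 * KN') := by
    rw [bubble_eq_biBubble]
    refine hframe ν b (Ga n a) (Ga n a) (grad Cf) (grad (ndlRow n a μ u)) (hsumψ hbr) Φ0 Φ1 KN KN' hΦ0pos hΦ1pos hKN hKN'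
      (fun q g hq => ?_) (fun q g i hq => ?_) (fun q f _ => hN u q f) (fun q f i _ => hN' u q f i)
    · rw [applyKT_eq_applyK_of_symm a ha n]; exact hwΦ0 q g hq
    · rw [applyKT_eq_applyK_of_symm a ha n]; exact hwΦ1 q g i hq
  -- term 2: the roles exchanged
  have ht2 : |bubble (Ga n a) (outer (grad (ndlRow n a μ u)) (grad Cf)) (SbT ν b)| ≤ K * (KN' * Φ0 + KN * Φ1 + KN' * Φ1) := by
    rw [bubble_eq_biBubble]
    refine hframe ν b (Ga n a) (Ga n a) (grad (ndlRow n a μ u)) (grad Cf) (hsumψ hbc) KN KN' Φ0 Φ1 hKN hKN' hΦ0pos hΦ1pos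
      (fun q g _ => ?_) (fun q g i _ => ?_) (fun q f hq => hwΦ0 q f hq) (fun q f i hq => hwΦ1 q f i hq)
    · rw [applyKT_eq_applyK_of_symm a ha n]; exact hN u q g
    · rw [applyKT_eq_applyK_of_symm a ha n]; exact hN' u q g i
  -- assemble
  rw [hword, abs_mul, show |(-(1 / 2 : ℝ))| = 1 / 2 by norm_num]
  have htri : |bubble (Ga n a) (outer (grad Cf) (grad (ndlRow n a μ u))) (SbT ν b) - bubble (Ga n a) (outer (grad (ndlRow n a μ u)) (grad Cf)) (SbT ν b)|
      ≤ |bubble (Ga n a) (outer (grad Cf) (grad (ndlRow n a μ u))) (SbT ν b)| + |bubble (Ga n a) (outer (grad (ndlRow n a μ u)) (grad Cf)) (SbT ν b)| :=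
    abs_sub _ _
  calc (1 / 2 : ℝ) * |bubble (Ga n a) (outer (grad Cf) (grad (ndlRow n a μ u))) (SbT ν b)
        - bubble (Ga n a) (outer (grad (ndlRow n a μ u)) (grad Cf)) (SbT ν b)|
      ≤ (1 / 2 : ℝ) * (K * (Φ1 * KN + Φ0 * KN' + Φ1 * KN') + K * (KN' * Φ0 + KN * Φ1 + KN' * Φ1)) :=
        mul_le_mul_of_nonneg_left (htri.trans (add_le_add ht1 ht2)) (by norm_num)
    _ = K * (Φ1 * (KN + KN') + Φ0 * KN') := by ring
    _ = _ := by rw [hΦ0, hΦ1]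

end Summit.QuantumFields.BalabanUV.Beta.D1BFx.GluonNdlLocalWord

end
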